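import Summits.Langlands.Langlands.Theses.SteinbergVelocityDst

/-!
# Birth skeleton (BC3) of the crux `InfinitesimalWeightVelocity` (stmt-Langlands-14048)

Route `SteinbergVelocityDst` (generation 3 of the weight-velocity line), crux rank 2 — "full infinitesimal WEIGHT VELOCITY of
the global tangent directions at `v`": in the setting of the target `MaximalMonodromyDst` (K CM, π regular algebraic cuspidal on
`GL_n(𝔸_K)`, accessible at `p`, `ρ` semisimple Satake-compatible, `v ∣ p` in the sector, `π_v` Steinberg, an embedded finite
coefficient field `E₀ ⊂ ℚ̄_p`, an `E₀`-model `r_K`, a pinned `(φ,Γ)`-package `(𝔇, 𝓐, 𝓒)` and a special semistable triangular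
`D = D_rig(r_K|K_v)` with parameters `𝓡(δ_j)`), for every consecutive pair `(i, i+1)` every continuous additive
`φ : K_vˣ → E₀` agrees ON THE UNITS `{v = 1}` with an `E₀`-combination of gap derivatives `ψ_i(δ̃_k)` of finitely many GLOBAL
first-order deformations `ρ̃_k : Γ_K → GL_n(E₀[ε])` of `r_K` whose `D_rig` at `v` is triangular with relative parameters
`𝓒.ofCharOver E₀[ε] (δ̃_{k,j})` lifting `δ_j` (`FramedGaloisRep.HasInfinitesimalGapVelocityAt`).

## The line: the rank / dimension sandwich ("numerical transversality of the weight map at `v`")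

Surjectivity onto `Hom_cont(𝒪_vˣ, E₀)` is obtained the way an eigenvariety delivers it — as a RANK statement pinched against a
DIMENSION bound:

* `stub_gapRank` (GLOBAL, load-bearing, open): in the crux setting there are `d_v := e(v|p)·f(v|p) = [K_v:ℚ_p]` global
  first-order deformations `(ρ̃_k, δ̃_k, Ũ_k)_{k < d_v}` of `r_K`, trianguline at `v` lifting `δ` (the three clauses of
  `HasInfinitesimalGapVelocityAt` VERBATIM), whose gap derivatives at the pair `(i, i+1)` restricted to the units are
  `E₀`-LINEARLY INDEPENDENT.  Intended proof: the tangent space of Hansen's eigenvariety for `Res_{K/ℚ} GL_n` at the accessible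
  refined point `x(π)` (Newton's bound `dim_x ≥ [K⁺:ℚ]n + 1`, hence a lower bound on the rank of the differential of the weight
  map), KPX interpolation of the triangulation over `E₀[ε]` transported through `𝓐` (`IsFunctorial`, `HasBCEquivalence`), and
  transversality of the `(v; i, i+1)`-gap component — a rank is exactly what dimension theory outputs.
  [cite: HansenUniversalEigenvarieties2017, Thm. 1.1.6] [cite: KedlayaPottharstXiao2014, Thm. 6.3.13]
  [cite: BarreraGrahamWilliams2026, Rem. 1.3–1.4]
* `stub_unitCharBound` (LOCAL, Literature-grade, provable in principle): for an embedded finite `E₀ ⊂ ℚ̄_p` the `E₀`-span, as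
  functions on the units of `K_v`, of all continuous additive characters of `K_vˣ` together with all gap derivatives of pairs
  of continuous characters `K_vˣ → (E₀[ε])ˣ` (`unitCharSpace v E₀`) is finite-dimensional of `finrank ≤ e(v|p)·f(v|p)`:
  gap derivatives are continuous additive (`gapDerivative_mul` + continuity of inversion on `E₀ˣ`), a continuous additive
  `χ : 𝒪_vˣ → E₀` kills torsion and is `ℤ_p`-linear on `1 + 𝔭_v^N ≅ 𝒪_v ≅ ℤ_p^{[K_v:ℚ_p]}` (p-adic logarithm; `E₀` is a
  Hausdorff topological `ℚ_p`-vector space through `emb`), so `dim_{E₀} Hom_cont(𝒪_vˣ, E₀) ≤ [K_v:ℚ_p] = e·f`.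
  [cite: Ding2019SimpleL, §1 (Notation): `dim_E Hom(Fˣ, E) = [F:ℚ_p] + 1`] [cite: NeukirchANT1999, Ch. II Prop. 5.7 (i)]

Composition `InfinitesimalWeightVelocity_of` (kernel-checked, no `sorry`): the span `S` of the `d_v` independent unit-restricted
gap derivatives lies in `unitCharSpace v E₀`, `finrank S = d_v ≥ finrank (unitCharSpace)` with the latter finite, so
`S = unitCharSpace` (`Submodule.eq_of_le_of_finrank_le`); hence `φ|units ∈ S`, i.e. `φ|units = Σ_k c_k ψ_i(δ̃_k)|units`
(`Submodule.mem_span_range_iff_exists_fun`) — the crux with `r := d_v`.  Sorries: exactly two, one per `stub_*`.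

Disproof used: none exists (`ledger crux ls stmt-Langlands-14048`, 2026-08-17: no workfiles; no
`Theorems/InfinitesimalWeightVelocity/Negative/`).  Dead lines: none recorded on this crux (gen-2 crux WeightVelocity
stmt-13450 died of PACKAGING defects R1/R1b/R2, repaired in the gen-3 typing this file imports; the mechanism is unchanged).
-/

set_option linter.dupNamespace false
set_option linter.unusedVariables false

open scoped NumberField
open IsDedekindDomain Literature.NumberTheory.GaloisRepresentations
open Summit.Langlands.Langlands.Theses.SteinbergVelocityDst

namespace Summit.Langlands.Langlands.Cruxes.InfinitesimalWeightVelocity.Birth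

/-! ## 0. Two canonical objects of the setting (plain definitions) -/

section Defs

variable {K : Type} [Field K] [NumberField K]

/-- The unit sphere `{x ∈ K_vˣ | v(x) = 1} = 𝒪_vˣ` of the completion `K_v`, as a subtype of `K_vˣ` — the set on which
`HasInfinitesimalGapVelocityAt` compares `φ` with the gap derivatives. [folklore] -/
abbrev UnitSphere (v : HeightOneSpectrum (𝓞 K)) : Type :=
  {x : (v.adicCompletion K)ˣ // Valued.v (x : v.adicCompletion K) = 1}

/-- Restriction of `E₀`-valued functions on `K_vˣ` to the unit sphere, an `E₀`-linear map. [folklore] -/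
def unitsRes (v : HeightOneSpectrum (𝓞 K)) (E₀ : Type) [Semiring E₀] :
    ((v.adicCompletion K)ˣ → E₀) →ₗ[E₀] (UnitSphere v → E₀) :=
  LinearMap.funLeft E₀ E₀ (Subtype.val : UnitSphere v → (v.adicCompletion K)ˣ)

/-- **The unit character space** of `K_v` with coefficients in `E₀`: the `E₀`-span, AS FUNCTIONS ON THE UNITS, of all
continuous additive characters `K_vˣ → E₀` (`HomCont`) together with all gap derivatives `ψ = snd/fst (δ̃₁δ̃₂⁻¹)` of pairs of
continuous first-order characters `δ̃₁, δ̃₂ : K_vˣ → (E₀[ε])ˣ`.  For genuine (embedded `p`-adic) `E₀` this is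
`Hom_cont(𝒪_vˣ, E₀)`, of dimension `[K_v:ℚ_p]` — that is `stub_unitCharBound`; here only the definition. [folklore] -/
def unitCharSpace (v : HeightOneSpectrum (𝓞 K)) (E₀ : Type) [Field E₀] [TopologicalSpace E₀] [IsTopologicalRing E₀] :
    Submodule E₀ (UnitSphere v → E₀) :=
  Submodule.span E₀ (unitsRes v E₀ ''
    ({f | f ∈ HomCont (v.adicCompletion K) E₀} ∪
     {f | ∃ δ₁ δ₂ : (v.adicCompletion K)ˣ →ₜ* (DualNumber E₀)ˣ, f = gapDerivative δ₁ δ₂}))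

end Defs

/-! ## 1. Registered stubs -/

/-- STUB 1 — **gap rank `d_v`** (GLOBAL; the load-bearing stub, crux-strength modulo local class field theory; size XL,
open): in the setting of the crux, for every consecutive pair `(i, i+1)` there exist `d_v = e(v|p)·f(v|p)` global first-order
deformations `ρ̃_k : Γ_K →ₜ* GL_n(E₀[ε])` of `r_K` (`fst ∘ ρ̃_k = r_K` entrywise), first-order characters `δ̃_{k,j}` lifting
`δ_j` and bases `Ũ_k` with `(𝓐.drigOverDualNumber (ρ̃_k|K_v)).conj Ũ_k` upper-triangular with relative parameters
`𝓒.ofCharOver E₀[ε] (δ̃_{k,j})` — the three clauses of `HasInfinitesimalGapVelocityAt` verbatim — whose gap derivatives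
`ψ_i(δ̃_k) = gapDerivative δ̃_{k,i} δ̃_{k,i+1}` restricted to the units `{v = 1}` are `E₀`-linearly independent.  The RANK form
of full weight velocity: what Newton's bound `dim_{x(π)} ≥ [K⁺:ℚ]n + 1` on Hansen's eigenvariety, KPX interpolation of the
refinement over `E₀[ε]` (through `𝓐`) and transversality of the `(v;i,i+1)`-gap component of the weight map would deliver.
Why it might fail = the crux's: the global tangent directions may span only a hyperplane of gap directions at `v` (a dual
Selmer class invisible away from `v`; zero slack at `n = 2`, `d_v = [K⁺:ℚ]`).
[cite: HansenUniversalEigenvarieties2017, Thm. 1.1.6] [cite: KedlayaPottharstXiao2014, Thm. 6.3.13]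
[cite: BarreraGrahamWilliams2026, Rem. 1.3–1.4] [cite: Ding2019SimpleL, Thm. 3.4 and Prop. 3.6] -/
theorem stub_gapRank :
    ∀ (K : Type) [Field K] [NumberField K] [NumberField.IsCMField K] (n : ℕ) (hcpt : Literature.NumberTheory.Automorphic.isCompact_glFiniteIntegralLevel n K) (π : Literature.NumberTheory.Automorphic.CuspidalAutomorphicRepData n K hcpt), 2 ≤ n → π.1.IsRegularAlgebraic → ∀ (p : ℕ) [Fact p.Prime] (ι : PadicAlgCl p ≃+* ℂ) (ρ : Literature.NumberTheory.GaloisRepresentations.FramedGaloisRep K (PadicAlgCl p) n), ρ.toGaloisRep.IsSemisimple → (∀ᶠ v : IsDedekindDomain.HeightOneSpectrum (NumberField.RingOfIntegers K) in Filter.cofinite, ∀ α : Multiset ℂ, π.1.HasSatakeParamAt v α → ρ.IsUnramifiedAt v ∧ ρ.HasFrobCharpolyAt v (Literature.NumberTheory.Automorphic.arithFrobPolyOfSatake ι v.residueCard n α)) → ∀ (v : IsDedekindDomain.HeightOneSpectrum (NumberField.RingOfIntegers K)) (hv : ((p : ℕ) : NumberField.RingOfIntegers K) ∈ v.asIdeal),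 (3 ≤ n ∨ 2 * (v.asIdeal.ramificationIdx ℤ * v.asIdeal.inertiaDeg ℤ) ≤ Module.finrank ℚ K) → (∀ (L : Literature.NumberTheory.Automorphic.LocalLanglandsDatum (v.adicCompletion K)) (πv : Literature.NumberTheory.Automorphic.SmoothIrrep (Matrix.GeneralLinearGroup (Fin n) (v.adicCompletion K))), π.1.HasLocalComponentAt v πv.ρ → ((L.recGL n (Literature.NumberTheory.Automorphic.IrrClass.mk πv)).out.1).N ^ (n - 1) ≠ 0) → (∀ w : Literature.NumberTheory.Automorphic.PlacesOver K p, ∃ (πw : Literature.NumberTheory.Automorphic.SmoothIrrep (Matrix.GeneralLinearGroup (Fin n) (w.1.adicCompletion K))) (χw : (Fin n → (w.1.adicCompletion K)ˣ) →* ℂˣ), π.1.HasLocalComponentAt w.1 πw.ρ ∧ Literature.NumberTheory.Automorphic.IsJacquetExponent πw χw) → ∀ (E₀ : Type) [Field E₀] [TopologicalSpace E₀] [IsTopologicalRing E₀] [Algebra ℚ_[p] E₀] [Module.Finite ℚ_[p] E₀] (emb : E₀ →+* PadicAlgCl p) (hemb : Topology.IsEmbedding emb), (∀ x : ℚ_[p],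 emb (algebraMap ℚ_[p] E₀ x) = algebraMap ℚ_[p] (PadicAlgCl p) x) → ∀ (rK : Literature.NumberTheory.GaloisRepresentations.FramedGaloisRep K E₀ n), (∃ P : Matrix.GeneralLinearGroup (Fin n) (PadicAlgCl p), Literature.NumberTheory.GaloisRepresentations.FramedRep.conj P (rK.baseChange emb hemb.continuous) = ρ) → ∀ (𝔇 : Literature.NumberTheory.GaloisRepresentations.PhiGammaModuleRobbaLog.{0, 0, 0} p (v.adicCompletion K) E₀) (𝓐 : 𝔇.DrigArtinian) (𝓒 : 𝔇.RelativeCharData), 𝔇.IsSteinbergVelocityPackage 𝓐 𝓒 (v.asIdeal.ramificationIdx ℤ * v.asIdeal.inertiaDeg ℤ) (v.asIdeal.inertiaDeg ℤ) → ∀ (U : Matrix.GeneralLinearGroup (Fin n) 𝔇.R) (δ : Fin n → ((v.adicCompletion K)ˣ →ₜ* E₀ˣ)) (h : ((𝔇.Drig (rK.toLocal v)).conj U).IsTriangularWith (fun j => ((𝔇.ofChar (δ j)).α : 𝔇.R)) (fun j σ => ((𝔇.ofChar (δ j)).c σ : 𝔇.R))), 𝔇.IsCyclotomic ((𝔇.Drig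 (rK.toLocal v)).conj U) → ((𝔇.Drig (rK.toLocal v)).conj U).toPhiGammaModule.IsContinuous → (∀ (i : ℕ) (hi : i + 1 < n), Module.finrank E₀ (𝔇.H2 ((Literature.NumberTheory.GaloisRepresentations.PhiGammaModule.Triangulation.ofTriangular ((𝔇.Drig (rK.toLocal v)).conj U) (fun j => 𝔇.ofChar (δ j)) h).ratioParam i hi).toModule) = 1) → 𝔇.IsSemistable ((𝔇.Drig (rK.toLocal v)).conj U).toPhiGammaModule (v.asIdeal.inertiaDeg ℤ) → ∀ (i : ℕ) (hi : i + 1 < n),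
      haveI : Module.Finite E₀ (DualNumber E₀) := moduleFinite_dualNumber E₀
      ∃ (ρε : Fin (v.asIdeal.ramificationIdx ℤ * v.asIdeal.inertiaDeg ℤ) → FramedGaloisRep K (DualNumber E₀) n)
        (δε : Fin (v.asIdeal.ramificationIdx ℤ * v.asIdeal.inertiaDeg ℤ) → Fin n →
          ((v.adicCompletion K)ˣ →ₜ* (DualNumber E₀)ˣ))
        (Uε : Fin (v.asIdeal.ramificationIdx ℤ * v.asIdeal.inertiaDeg ℤ) →
          Matrix.GeneralLinearGroup (Fin n) (𝔇.ring.baseChange (DualNumber E₀)).R),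
        (∀ (k : Fin (v.asIdeal.ramificationIdx ℤ * v.asIdeal.inertiaDeg ℤ)) (σ : Field.absoluteGaloisGroup K)
            (a b : Fin n),
          TrivSqZeroExt.fst (((ρε k) σ : Matrix.GeneralLinearGroup (Fin n) (DualNumber E₀)) a b) =
            (rK σ : Matrix.GeneralLinearGroup (Fin n) E₀) a b) ∧
        (∀ (k : Fin (v.asIdeal.ramificationIdx ℤ * v.asIdeal.inertiaDeg ℤ)) (j : Fin n) (x : (v.adicCompletion K)ˣ),
          TrivSqZeroExt.fst ((δε k j x : (DualNumber E₀)ˣ) : DualNumber E₀) = ((δ j x : E₀ˣ) : E₀)) ∧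
        (∀ k : Fin (v.asIdeal.ramificationIdx ℤ * v.asIdeal.inertiaDeg ℤ),
          ((𝓐.drigOverDualNumber ((ρε k).toLocal v)).conj (Uε k)).IsTriangularWith
            (fun j => ((𝓒.ofCharOver (DualNumber E₀) (δε k j)).α : (𝔇.ring.baseChange (DualNumber E₀)).R))
            (fun j σ => ((𝓒.ofCharOver (DualNumber E₀) (δε k j)).c σ : (𝔇.ring.baseChange (DualNumber E₀)).R))) ∧
        LinearIndependent E₀ (fun k : Fin (v.asIdeal.ramificationIdx ℤ * v.asIdeal.inertiaDeg ℤ) =>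
          unitsRes v E₀ (gapDerivative (δε k ⟨i, Nat.lt_of_succ_lt hi⟩) (δε k ⟨i + 1, hi⟩))) := by
  sorry

/-- STUB 2 — **the unit character bound** (LOCAL; Literature-grade, provable in principle, size L): for a finite place `v` of a
number field `K` above `p` and a finite extension `E₀/ℚ_p` topologically embedded in `ℚ̄_p` (the crux's coefficient binders),
the unit character space `unitCharSpace v E₀` — unit-restrictions of continuous additive characters of `K_vˣ` and of gap
derivatives of pairs of continuous characters `K_vˣ → (E₀[ε])ˣ` — is a finite-dimensional `E₀`-vector space of
`finrank ≤ e(v|p)·f(v|p) = [K_v:ℚ_p]`.  Proof on paper: a gap derivative is additive (`gapDerivative_mul`) and continuous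
(`fst` of the ratio is the unit `δ_i δ_{i+1}⁻¹(x) ∈ E₀ˣ`, inversion is continuous on `E₀ˣ`), so everything lies in the
unit-restriction of `Hom_cont(K_vˣ, E₀)`, i.e. in `Hom_cont(𝒪_vˣ, E₀)`; a continuous additive `χ : 𝒪_vˣ → E₀` vanishes on
torsion (char 0) and is `ℤ_p`-linear on `1 + 𝔭_v^N ≅ (𝒪_v, +) ≅ ℤ_p^{e f}` (`exp/log`, `ℤ` dense in `ℤ_p`, `E₀` Hausdorff
topological `ℚ_p`-space via `emb`), and `χ ↦ χ|_{1+𝔭^N}` is injective (the quotient is finite, `E₀` torsion-free): `dim ≤ e f`.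
Why it might fail: only by mis-typing (it is false for the indiscrete topology on `E₀`, excluded by `Topology.IsEmbedding emb`).
[cite: Ding2019SimpleL, §1 (Notation)] [cite: NeukirchANT1999, Ch. II Prop. 5.7 (i): `K^× ≅ ℤ ⊕ ℤ/(q-1) ⊕ ℤ/p^a ⊕ ℤ_p^d`, `d = [K:ℚ_p]`, algebraically and topologically] -/
theorem stub_unitCharBound :
    ∀ (K : Type) [Field K] [NumberField K] (p : ℕ) [Fact p.Prime]
      (v : IsDedekindDomain.HeightOneSpectrum (NumberField.RingOfIntegers K)),
      ((p : ℕ) : NumberField.RingOfIntegers K) ∈ v.asIdeal →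
      ∀ (E₀ : Type) [Field E₀] [TopologicalSpace E₀] [IsTopologicalRing E₀] [Algebra ℚ_[p] E₀] [Module.Finite ℚ_[p] E₀]
        (emb : E₀ →+* PadicAlgCl p) (hemb : Topology.IsEmbedding emb),
        (∀ x : ℚ_[p], emb (algebraMap ℚ_[p] E₀ x) = algebraMap ℚ_[p] (PadicAlgCl p) x) →
        Module.Finite E₀ (unitCharSpace v E₀) ∧
          Module.finrank E₀ (unitCharSpace v E₀) ≤ v.asIdeal.ramificationIdx ℤ * v.asIdeal.inertiaDeg ℤ := by
  sorry

/-! ## 2. The stub statements as named propositions (`type_of%`: literally the stub types, no text duplicated, no `sorry`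
inherited) -/

namespace _Goal

/-- The statement of `stub_gapRank` (literally its type). [folklore] -/
def stub_gapRank : Prop :=
  type_of% @Summit.Langlands.Langlands.Cruxes.InfinitesimalWeightVelocity.Birth.stub_gapRank

/-- The statement of `stub_unitCharBound` (literally its type). [folklore] -/
def stub_unitCharBound : Prop :=
  type_of% @Summit.Langlands.Langlands.Cruxes.InfinitesimalWeightVelocity.Birth.stub_unitCharBound

end _Goal

/-! ## 3. The composition (kernel-checked, no `sorry`): rank `d_v` inside a space of dimension `≤ d_v` ⇒ the gap
derivatives SPAN the unit character space ⇒ the crux by name -/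

/-- **`InfinitesimalWeightVelocity` from its two stubs** (hypotheses = the stub statements by name, conclusion = the route
decl by name).  Linear algebra: the span `S` of the `d_v` independent unit-restricted gap derivatives of `stub_gapRank` sits
in `unitCharSpace v E₀`, has `finrank S = d_v ≥ finrank (unitCharSpace v E₀)` by `stub_unitCharBound`, so
`S = unitCharSpace v E₀` (`Submodule.eq_of_le_of_finrank_le`); `φ|units ∈ unitCharSpace v E₀` by definition, hence
`φ|units = Σ_k c_k • ψ_i(δ̃_k)|units` (`Submodule.mem_span_range_iff_exists_fun`), which is the crux with `r := d_v`. [folklore] -/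
theorem InfinitesimalWeightVelocity_of (h₁ : _Goal.stub_gapRank) (h₂ : _Goal.stub_unitCharBound) :
    InfinitesimalWeightVelocity := by
  dsimp only [_Goal.stub_gapRank, _Goal.stub_unitCharBound] at h₁ h₂
  intro K _ _ _ n hcpt π hn hreg p _ ι ρ hss hcomp v hv hsec hSt hacc E₀ _ _ _ _ _ emb hemb hQp rK hmod 𝔇 𝓐 𝓒 hP U δ h
    hcyc hcont hspec hsst i hi
  obtain ⟨ρε, δε, Uε, hfst, hlift, htri, hli⟩ :=
    h₁ K n hcpt π hn hreg p ι ρ hss hcomp v hv hsec hSt hacc E₀ emb hemb hQp rK hmod 𝔇 𝓐 𝓒 hP U δ h hcyc hcont hspec hsst i hi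
  obtain ⟨hfin, hrank⟩ := h₂ K p v hv E₀ emb hemb hQp
  intro φ
  -- the `d_v` unit-restricted gap derivatives, linearly independent by `stub_gapRank`
  let g : Fin (v.asIdeal.ramificationIdx ℤ * v.asIdeal.inertiaDeg ℤ) → (UnitSphere v → E₀) := fun k =>
    unitsRes v E₀ (gapDerivative (δε k ⟨i, Nat.lt_of_succ_lt hi⟩) (δε k ⟨i + 1, hi⟩))
  have hli' : LinearIndependent E₀ g := hli
  -- their span lies in the unit character space …
  have hle : Submodule.span E₀ (Set.range g) ≤ unitCharSpace v E₀ := by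
    rw [Submodule.span_le]
    rintro _ ⟨k, rfl⟩
    exact Submodule.subset_span ⟨_, Or.inr ⟨_, _, rfl⟩, rfl⟩
  -- … has dimension `d_v` …
  have hcard : Module.finrank E₀ (Submodule.span E₀ (Set.range g)) =
      v.asIdeal.ramificationIdx ℤ * v.asIdeal.inertiaDeg ℤ := by
    rw [finrank_span_eq_card hli', Fintype.card_fin]
  -- … and the unit character space is finite of dimension `≤ d_v` (`stub_unitCharBound`): they coincide
  haveI : Module.Finite E₀ (unitCharSpace v E₀) := hfin
  have heq : Submodule.span E₀ (Set.range g) = unitCharSpace v E₀ :=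
    Submodule.eq_of_le_of_finrank_le hle (by rw [hcard]; exact hrank)
  -- so `φ|units`, a member of the unit character space, is a combination of the `g k`
  have hφ : unitsRes v E₀ (φ : (v.adicCompletion K)ˣ → E₀) ∈ Submodule.span E₀ (Set.range g) := by
    rw [heq]
    exact Submodule.subset_span ⟨_, Or.inl φ.2, rfl⟩
  obtain ⟨c, hc⟩ := (Submodule.mem_span_range_iff_exists_fun E₀).1 hφ
  refine ⟨_, ρε, δε, Uε, c, hfst, hlift, htri, fun x hx => ?_⟩
  have hcx := congr_fun hc ⟨x, hx⟩
  rw [Finset.sum_apply] at hcx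
  simpa [g, unitsRes, LinearMap.funLeft_apply] using hcx.symm

/-- The same composition with the two registered stubs consumed BY NAME (kernel check that the hypotheses of
`InfinitesimalWeightVelocity_of` are the stub signatures verbatim; inherits their `sorry`s, contains none). [folklore] -/
theorem InfinitesimalWeightVelocity_of_stubs : InfinitesimalWeightVelocity :=
  InfinitesimalWeightVelocity_of stub_gapRank stub_unitCharBound

end Summit.Langlands.Langlands.Cruxes.InfinitesimalWeightVelocity.Birth
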